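import Mathlib
import HarnessLib
import HarnessLib.Audit
import Summits.ValiantsHypothesis.ValiantsHypothesis.Theorems.SoloBlindCoreRefutation

/-!
# The two-sum form of the core vertex bound: refutation of the sharp form, the linear conjecture, and the bridge

`CoreVertexBoundPos` / `CoreVertexBoundLin` (files `SoloBlindCoreVertexBoundFix`, `SoloBlindCoreRefutation`) are the
lattice/semigroup kernels of Koiran–Portier–Tavenas–Thomassé's open problem 1 (arXiv:1308.2286, §5) in the reduction
recorded by this seat.  Here is the self-contained additive-convex form with no semigroup in it.

Data: a finite set `I ⊆ ℤ²` with `0 ∈ I`; write `A = I ∖ {0}` and let `W(I) = (A + A) ∖ I` be the set of *outer* pair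
sums (`outerSums`).  Think of `H = conv W + cone A`.
* `Separated I y`: some integer functional, nonnegative on `A`, is strictly smaller at `y` than on all of `W`
  (`y ∉ H`).  The instance is *valid* when every point of `I` is separated.
* `IsStrictVertex I v`: `v ∈ W` and some integer functional, positive on `A`, is uniquely minimised over `W` at `v`.
* `TwoSumVertexBound` — the SHARP form "a valid instance has at most `#I` strict vertices" — is **false**:
  `not_twoSumVertexBound` in the companion file `SoloBlindTwoSumRefutation`, by the eight-point instance
  `cxD = {0,(5,10),(8,4),(8,9),(10,20),(14,30),(16,8),(48,20)}` with nine strict vertices (the configuration that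
  refutes `CoreVertexBoundPos`).
* `TwoSumVertexBoundLin` (CONJECTURE, a `Prop`, not asserted): a valid instance has at most `c·#I` strict vertices
  for an absolute constant `c`.  `exists_twoSum_model` + `coreVertexBoundLin_of_twoSumVertexBoundLin`: it implies
  `CoreVertexBoundLin` (given core data `Q, V, D`, the set `I = {0} ∪ {y ∈ D : y ∈ ℕQ separated from V}` is a valid
  instance for which every non-generator vertex is a strict vertex).
* `witness_mem` is the WITNESS LEMMA used by every charging argument: if `v_a = p + x`, `v_b = q + y`, `v_i = p + q`
  are outer sums, `v_b` is a strict vertex with functional `f`, `v_a ≠ v_i` and `f v_a ≤ f v_i`, then the *witness*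
  `x + y = v_a + v_b - v_i` is an element of `I`.

References: Koiran–Portier–Tavenas–Thomassé 2015 (arXiv:1308.2286) §5, problem 1.
-/

namespace Summit.ValiantsHypothesis.ValiantsHypothesis.Theorems

open Finset

/-- The integer linear functional `x ↦ a·x₁ + b·x₂` on `ℤ²`. -/
def lin (a b : ℤ) (x : ℤ × ℤ) : ℤ := a * x.1 + b * x.2

/-- `lin` is additive in the point. -/
@[simp] theorem lin_add (a b : ℤ) (x y : ℤ × ℤ) :
    lin a b (x + y) = lin a b x + lin a b y := by
  simp only [lin, Prod.fst_add, Prod.snd_add]; ring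

/-- `lin` vanishes at the origin. -/
@[simp] theorem lin_zero (a b : ℤ) : lin a b (0 : ℤ × ℤ) = 0 := by simp [lin]

/-- `lin` is linear in the coefficients: `lin (k a + c) (k b + d) = k·lin a b + lin c d`. -/
theorem lin_coeff_add (a b c d k : ℤ) (x : ℤ × ℤ) :
    lin (k * a + c) (k * b + d) x = k * lin a b x + lin c d x := by
  simp only [lin]; ring

/-- Outer pair sums `W(I) = ((I∖0) + (I∖0)) ∖ I`. -/
def outerSums (I : Finset (ℤ × ℤ)) : Finset (ℤ × ℤ) :=
  (((I.erase 0) ×ˢ (I.erase 0)).image (fun pq : (ℤ × ℤ) × (ℤ × ℤ) => pq.1 + pq.2)).filter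
    (fun w => w ∉ I)

/-- Membership in `outerSums I`: a sum of two nonzero points of `I` that is not itself in `I`. -/
theorem mem_outerSums {I : Finset (ℤ × ℤ)} {w : ℤ × ℤ} :
    w ∈ outerSums I ↔ (∃ p ∈ I.erase 0, ∃ q ∈ I.erase 0, p + q = w) ∧ w ∉ I := by
  unfold outerSums
  rw [Finset.mem_filter, Finset.mem_image]
  constructor
  · rintro ⟨⟨pq, hpq, rfl⟩, hw⟩
    rw [Finset.mem_product] at hpq
    exact ⟨⟨pq.1, hpq.1, pq.2, hpq.2, rfl⟩, hw⟩
  · rintro ⟨⟨p, hp, q, hq, rfl⟩, hw⟩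
    exact ⟨⟨(p, q), Finset.mem_product.mpr ⟨hp, hq⟩, rfl⟩, hw⟩

/-- `y` is strictly separated from the outer sums by an integer functional nonnegative on `A = I∖0`
(i.e. `y ∉ conv W(I) + cone A`). -/
def Separated (I : Finset (ℤ × ℤ)) (y : ℤ × ℤ) : Prop :=
  ∃ a b : ℤ, (∀ e ∈ I.erase 0, 0 ≤ lin a b e) ∧ ∀ w ∈ outerSums I, lin a b y < lin a b w

/-- `v` is a strict vertex of `conv W(I) + cone A`: an outer sum at which some integer functional,
positive on `A`, is uniquely minimised over `W(I)`. -/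
def IsStrictVertex (I : Finset (ℤ × ℤ)) (v : ℤ × ℤ) : Prop :=
  v ∈ outerSums I ∧ ∃ a b : ℤ, (∀ e ∈ I.erase 0, 0 < lin a b e) ∧
    ∀ w ∈ outerSums I, w ≠ v → lin a b v < lin a b w

/-- **Two-sum vertex bound, sharp form** — REFUTED (`not_twoSumVertexBound`, file `SoloBlindTwoSumRefutation`).  If `0 ∈ I ⊆ ℤ²` is finite and
every point of `I` is strictly separated from the outer pair sums `W(I) = ((I∖0)+(I∖0)) ∖ I`, then
`conv W(I) + cone (I∖0)` has at most `#I` strict vertices.  Kept as a named `Prop` because its negation is a theorem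
of the companion file (tagged `conjecture` only so that the refutation registers as a negative edge) and because
the linear form `TwoSumVertexBoundLin` refers to the same data. -/
@[conjecture] def TwoSumVertexBound : Prop :=
  ∀ I V : Finset (ℤ × ℤ), (0 : ℤ × ℤ) ∈ I → (∀ y ∈ I, Separated I y) →
    (∀ v ∈ V, IsStrictVertex I v) → V.card ≤ I.card

/-- **Two-sum vertex bound, linear form** (conjecture).  A valid instance has at most `c·#I` strict vertices, for an
absolute constant `c`.  Evidence (this seat): `c = 1` fails only through adjacent doubled elements sharing a pocket
point (ratio `#V/#I → 4/3` along chains of them); no instance with `#V > (4/3)#I + 2` is known.  CONJECTURAL — a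
`Prop`, not asserted; implies `CoreVertexBoundLin` (`coreVertexBoundLin_of_twoSumVertexBoundLin`). -/
@[conjecture] def TwoSumVertexBoundLin : Prop :=
  ∃ c : ℕ, ∀ I V : Finset (ℤ × ℤ), (0 : ℤ × ℤ) ∈ I → (∀ y ∈ I, Separated I y) →
    (∀ v ∈ V, IsStrictVertex I v) → V.card ≤ c * I.card

/-! ### The witness lemma -/

/-- **Witness lemma.**  Let `v_a = p + x`, `v_b = q + y` and `v_i = p + q` be outer sums with
`x, y ∈ I∖0`, let `v_b` be a strict vertex with functional `(a,b)`, and suppose `v_a ≠ v_i` and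
`lin a b v_a ≤ lin a b v_i` (the functional form of: along the boundary, `v_a` lies weakly between
`v_b` and `v_i`; the case `v_a = v_b` is allowed).  Then the witness `x + y = v_a + v_b − v_i` is an
element of `I`.  Proof: `lin a b (x+y) = lin a b v_a + lin a b v_b − lin a b v_i ≤ lin a b v_b`, so
`x + y`, being a pair sum of elements, cannot be an outer sum other than `v_b` itself, and it is not
`v_b` because `v_a ≠ v_i`. -/
theorem witness_mem {I : Finset (ℤ × ℤ)} {a b : ℤ} {p q x y va vb vi : ℤ × ℤ}
    (hvb : ∀ w ∈ outerSums I, w ≠ vb → lin a b vb < lin a b w)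
    (hx : x ∈ I.erase 0) (hy : y ∈ I.erase 0)
    (ha : va = p + x) (hb : vb = q + y) (hi : vi = p + q)
    (hne : va ≠ vi) (hle : lin a b va ≤ lin a b vi) :
    x + y ∈ I := by
  by_contra hnot
  have hw : x + y ∈ outerSums I := mem_outerSums.mpr ⟨⟨x, hx, y, hy, rfl⟩, hnot⟩
  have hsum : lin a b (x + y) = lin a b va + lin a b vb - lin a b vi := by
    subst ha hb hi; simp only [lin_add]; ring
  by_cases hxy : x + y = vb
  · -- then `v_a = v_i`
    apply hne
    have h1 : p + x + (q + y) = p + q + (x + y) := by abel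
    rw [← ha, ← hb, ← hi, hxy] at h1
    exact add_right_cancel h1
  · have := hvb (x + y) hw hxy
    rw [hsum] at this
    linarith

/-- The witness is strictly high on the normal cone of `v_i`: for any strict-vertex functional of
`v_i` it exceeds the value at `v_i` (so it is never a summand of `v_i` or of a vertex beyond it). -/
theorem witness_high {a b : ℤ} {va vb vi : ℤ × ℤ} {W : Finset (ℤ × ℤ)}
    (hvi : ∀ w ∈ W, w ≠ vi → lin a b vi < lin a b w)
    (ha : va ∈ W) (hb : vb ∈ W) (hane : va ≠ vi) (hbne : vb ≠ vi) :
    lin a b vi < lin a b (va + vb - vi) := by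
  have h1 := hvi va ha hane
  have h2 := hvi vb hb hbne
  have : lin a b (va + vb - vi) = lin a b va + lin a b vb - lin a b vi := by
    simp only [lin, Prod.fst_add, Prod.snd_add, Prod.fst_sub, Prod.snd_sub]; ring
  rw [this]; linarith

/-! ### From the two-sum bound to the core vertex bound -/

/-- A functional positive on the generators is positive on every nonzero element of the generated
submonoid (and nonnegative everywhere on it). -/
theorem lin_pos_of_mem_closure {Q : Finset (ℤ × ℤ)} {a b : ℤ}
    (hq : ∀ q ∈ Q, 0 < lin a b q) {y : ℤ × ℤ}
    (hy : y ∈ AddSubmonoid.closure (↑Q : Set (ℤ × ℤ))) : 0 ≤ lin a b y ∧ (y ≠ 0 → 0 < lin a b y) := by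
  induction hy using AddSubmonoid.closure_induction with
  | mem x hx => exact ⟨le_of_lt (hq x (Finset.mem_coe.mp hx)), fun _ => hq x (Finset.mem_coe.mp hx)⟩
  | zero => exact ⟨by simp, fun h => absurd rfl h⟩
  | add x z _ _ ihx ihz =>
    refine ⟨by rw [lin_add]; linarith [ihx.1, ihz.1], fun hxz => ?_⟩
    rw [lin_add]
    by_cases hx0 : x = 0
    · have hz0 : z ≠ 0 := by
        rintro rfl
        exact hxz (by rw [hx0, add_zero])
      have := ihz.2 hz0
      linarith [ihx.1]
    · have := ihx.2 hx0
      linarith [ihz.1]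

/-- Peeling one generator: every element of the submonoid generated by `Q` is `0` or of the form
`s + q` with `s` in the submonoid and `q ∈ Q`. -/
theorem exists_peel {Q : Finset (ℤ × ℤ)} {y : ℤ × ℤ}
    (hy : y ∈ AddSubmonoid.closure (↑Q : Set (ℤ × ℤ))) :
    y = 0 ∨ ∃ s ∈ AddSubmonoid.closure (↑Q : Set (ℤ × ℤ)), ∃ q ∈ Q, y = s + q := by
  induction hy using AddSubmonoid.closure_induction with
  | mem x hx => exact Or.inr ⟨0, AddSubmonoid.zero_mem _, x, Finset.mem_coe.mp hx, by simp⟩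
  | zero => exact Or.inl rfl
  | add x z hx' hz' ihx ihz =>
    rcases ihz with rfl | ⟨s, hs, q, hq, rfl⟩
    · simpa using ihx
    · exact Or.inr ⟨x + s, AddSubmonoid.add_mem _ hx' hs, q, hq, by abel⟩

/-- A direction functional separating two distinct lattice points, with coefficients bounded by 1. -/
theorem exists_dir_lt {w v : ℤ × ℤ} (h : w ≠ v) :
    ∃ c d : ℤ, lin c d w < lin c d v ∧ ∀ x : ℤ × ℤ, |lin c d x| ≤ |x.1| + |x.2| := by
  rcases lt_trichotomy w.1 v.1 with h1 | h1 | h1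
  · exact ⟨1, 0, by simpa [lin] using h1, fun x => by simp [lin]⟩
  · rcases lt_trichotomy w.2 v.2 with h2 | h2 | h2
    · exact ⟨0, 1, by simpa [lin] using h2, fun x => by simp [lin]⟩
    · exact absurd (Prod.ext h1 h2) h
    · exact ⟨0, -1, by simpa [lin] using h2, fun x => by simp [lin]⟩
  · exact ⟨-1, 0, by simpa [lin] using h1, fun x => by simp [lin]⟩

/-- **The two-sum model of core data.**  Given `Q, V, D` as in `CoreVertexBoundPos`/`CoreVertexBoundLin`, the set
`I = {0} ∪ {y ∈ D : y ∈ ℕQ, y strictly separated from V}` satisfies `I ⊆ D`, is valid, and every non-generator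
vertex `v = s + q` (peel one generator) is an outer sum of the two separated points `s, q` and a strict vertex for `I`
(a point of `W(I)` on the supporting line of `v` would be separated by a perturbed functional, hence in `I`). -/
theorem exists_twoSum_model (Q V D : Finset (ℤ × ℤ)) (h0V : ((0 : ℤ), (0 : ℤ)) ∉ V)
    (hVcl : ∀ v ∈ V, v ∈ AddSubmonoid.closure (↑Q : Set (ℤ × ℤ)))
    (hvert : ∀ v ∈ V, ∃ a b : ℤ, (∀ q ∈ Q, 0 < a * q.1 + b * q.2) ∧
        ∀ w ∈ V, w ≠ v → a * v.1 + b * v.2 < a * w.1 + b * w.2)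
    (hD : ∀ y ∈ AddSubmonoid.closure (↑Q : Set (ℤ × ℤ)),
        (∃ a b : ℤ, (∀ q ∈ Q, 0 ≤ a * q.1 + b * q.2) ∧
          ∀ w ∈ V, a * y.1 + b * y.2 < a * w.1 + b * w.2) → y ∈ D) :
    ∃ I : Finset (ℤ × ℤ), (0 : ℤ × ℤ) ∈ I ∧ I ⊆ D ∧ (∀ y ∈ I, Separated I y) ∧
      ∀ v ∈ V \ Q, IsStrictVertex I v := by
  classical
  rcases V.eq_empty_or_nonempty with hVe | ⟨v₀, hv₀V⟩
  · subst hVe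
    refine ⟨{0}, Finset.mem_singleton_self _, ?_, ?_, ?_⟩
    · intro y hy
      rw [Finset.mem_singleton] at hy
      subst hy
      exact hD 0 (AddSubmonoid.zero_mem _) ⟨0, 0, fun q _ => by simp, fun w hw => by simp at hw⟩
    · intro y hy
      rw [Finset.mem_singleton] at hy
      subst hy
      refine ⟨0, 0, fun e _ => by simp [lin], fun w hw => ?_⟩
      obtain ⟨⟨p, hp, q, _, -⟩, -⟩ := mem_outerSums.mp hw
      simp at hp
    · intro v hv
      simp at hv
  obtain ⟨a₀, b₀, hpos₀, -⟩ := hvert v₀ hv₀V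
  -- core separation predicate and the set I
  let S : Set (ℤ × ℤ) := (AddSubmonoid.closure (↑Q : Set (ℤ × ℤ)) : Set (ℤ × ℤ))
  let sep : (ℤ × ℤ) → Prop := fun y =>
    ∃ a b : ℤ, (∀ q ∈ Q, 0 ≤ a * q.1 + b * q.2) ∧ ∀ w ∈ V, a * y.1 + b * y.2 < a * w.1 + b * w.2
  let I : Finset (ℤ × ℤ) := insert 0 (D.filter fun y => y ∈ S ∧ sep y)
  have hpos₀' : ∀ q ∈ Q, 0 < lin a₀ b₀ q := fun q hq => hpos₀ q hq
  -- members of V are nonzero elements of S, hence positive under (a₀,b₀)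
  have hVpos : ∀ w ∈ V, 0 < lin a₀ b₀ w := fun w hw =>
    (lin_pos_of_mem_closure hpos₀' (hVcl w hw)).2 (fun h0 => h0V (by subst h0; exact hw))
  -- 0 ∈ D, so I ⊆ D
  have h0D : (0 : ℤ × ℤ) ∈ D := by
    refine hD 0 (AddSubmonoid.zero_mem _) ⟨a₀, b₀, fun q hq => le_of_lt (hpos₀ q hq), fun w hw => ?_⟩
    have := hVpos w hw; simp only [lin] at this; simpa using this
  have hID : I ⊆ D := by
    intro y hy
    rcases Finset.mem_insert.mp hy with rfl | hy'
    · exact h0D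
    · exact (Finset.mem_filter.mp hy').1
  -- description of membership in I
  have memI : ∀ {y : ℤ × ℤ}, y ∈ S → sep y → y ∈ I := by
    intro y hyS hsep
    have hyD : y ∈ D := hD y hyS hsep
    exact Finset.mem_insert_of_mem (Finset.mem_filter.mpr ⟨hyD, hyS, hsep⟩)
  have of_memI : ∀ {y : ℤ × ℤ}, y ∈ I → y = 0 ∨ (y ∈ S ∧ sep y) := by
    intro y hy
    rcases Finset.mem_insert.mp hy with rfl | hy'
    · exact Or.inl rfl
    · exact Or.inr (Finset.mem_filter.mp hy').2
  have eraseI_S : ∀ {y : ℤ × ℤ}, y ∈ I.erase 0 → y ∈ S ∧ y ≠ 0 := by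
    intro y hy
    obtain ⟨hy0, hyI⟩ := Finset.mem_erase.mp hy
    rcases of_memI hyI with rfl | ⟨hyS, -⟩
    · exact absurd rfl hy0
    · exact ⟨hyS, hy0⟩
  -- outer sums of I lie in S and are positive under any functional positive on Q
  have outer_S : ∀ {w : ℤ × ℤ}, w ∈ outerSums I → w ∈ S ∧ w ∉ I := by
    intro w hw
    obtain ⟨⟨p, hp, q, hq, rfl⟩, hwI⟩ := mem_outerSums.mp hw
    exact ⟨AddSubmonoid.add_mem _ (eraseI_S hp).1 (eraseI_S hq).1, hwI⟩
  -- a point of S outside I is not core-separated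
  have not_sep : ∀ {w : ℤ × ℤ}, w ∈ S → w ∉ I → ¬ sep w := fun hwS hwI hs => hwI (memI hwS hs)
  -- Goal A: validity of I
  have goalA : ∀ y ∈ I, Separated I y := by
    intro y hy
    rcases of_memI hy with rfl | ⟨hyS, ⟨a, b, hq, hV⟩⟩
    · refine ⟨a₀, b₀, fun e he => (lin_pos_of_mem_closure hpos₀' (eraseI_S he).1).1, fun w hw => ?_⟩
      obtain ⟨⟨p, hp, q, hq, rfl⟩, -⟩ := mem_outerSums.mp hw
      have h1 := (lin_pos_of_mem_closure hpos₀' (eraseI_S hp).1).2 (eraseI_S hp).2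
      have h2 := (lin_pos_of_mem_closure hpos₀' (eraseI_S hq).1).2 (eraseI_S hq).2
      simp only [lin_zero, lin_add]; linarith
    · refine ⟨a, b, fun e he => linForm_nonneg_of_mem_closure hq (eraseI_S he).1, fun w hw => ?_⟩
      obtain ⟨hwS, hwI⟩ := outer_S hw
      have hns := not_sep hwS hwI
      -- ¬ sep w with the functional (a,b): some w' ∈ V has value ≤ that of w
      by_contra hlt
      push Not at hlt
      apply hns
      refine ⟨a, b, hq, fun w' hw' => ?_⟩
      have := hV w' hw'
      simp only [lin] at hlt
      linarith
  -- Goal B: every v ∈ V \ Q is a strict vertex for I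
  have goalB : ∀ v ∈ V \ Q, IsStrictVertex I v := by
    intro v hv
    obtain ⟨hvV, hvQ⟩ := Finset.mem_sdiff.mp hv
    obtain ⟨a, b, hposQ, hmin⟩ := hvert v hvV
    have hposQ' : ∀ q ∈ Q, 0 < lin a b q := fun q hq => hposQ q hq
    have hv0 : v ≠ 0 := fun h0 => h0V (by subst h0; exact hvV)
    have hvS : v ∈ S := hVcl v hvV
    -- peel: v = s + q
    obtain ⟨s, hsS, q, hqQ, hsq⟩ : ∃ s ∈ AddSubmonoid.closure (↑Q : Set (ℤ × ℤ)), ∃ q ∈ Q, v = s + q := by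
      rcases exists_peel hvS with h | h
      · exact absurd h hv0
      · exact h
    have hs0 : s ≠ 0 := by
      intro hs0; apply hvQ; rw [hsq, hs0, zero_add]; exact hqQ
    have hqS : q ∈ S := AddSubmonoid.subset_closure (Finset.mem_coe.mpr hqQ)
    have hs_pos : 0 < lin a b s := (lin_pos_of_mem_closure hposQ' hsS).2 hs0
    have hq_pos : 0 < lin a b q := hposQ' q hqQ
    have hq0 : q ≠ 0 := by intro h; rw [h] at hq_pos; simp at hq_pos
    have hv_le : ∀ w ∈ V, lin a b v ≤ lin a b w := by
      intro w hw
      by_cases hwv : w = v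
      · rw [hwv]
      · exact le_of_lt (hmin w hw hwv)
    have hv_lin : lin a b v = lin a b s + lin a b q := by rw [hsq, lin_add]
    -- s and q are separated by (a,b), hence in I
    have sep_of_lt : ∀ {y : ℤ × ℤ}, lin a b y < lin a b v → sep y := by
      intro y hy
      refine ⟨a, b, fun q hq => le_of_lt (hposQ q hq), fun w hw => ?_⟩
      have := hv_le w hw; simp only [lin] at hy this ⊢; linarith
    have hsI : s ∈ I.erase 0 :=
      Finset.mem_erase.mpr ⟨hs0, memI hsS (sep_of_lt (by rw [hv_lin]; linarith))⟩
    have hqI : q ∈ I.erase 0 :=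
      Finset.mem_erase.mpr ⟨hq0, memI hqS (sep_of_lt (by rw [hv_lin]; linarith))⟩
    have hvI : v ∉ I := by
      intro hvI
      rcases of_memI hvI with h | ⟨-, ⟨a', b', -, hV'⟩⟩
      · exact hv0 h
      · exact lt_irrefl _ (hV' v hvV)
    have hvW : v ∈ outerSums I := mem_outerSums.mpr ⟨⟨s, hsI, q, hqI, hsq.symm⟩, hvI⟩
    refine ⟨hvW, a, b, fun e he => (lin_pos_of_mem_closure hposQ' (eraseI_S he).1).2 (eraseI_S he).2,
      fun w hw hwv => ?_⟩
    -- strictness: otherwise a perturbed functional separates w, forcing w ∈ I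
    obtain ⟨hwS, hwI⟩ := outer_S hw
    by_contra hle
    push Not at hle
    obtain ⟨c, d, hcd, hbd⟩ := exists_dir_lt hwv
    let N : (ℤ × ℤ) → ℤ := fun x => |x.1| + |x.2|
    have hN : ∀ x, |lin c d x| ≤ N x := hbd
    let k : ℤ := 1 + N w + ∑ x ∈ V, N x + ∑ x ∈ Q, N x
    have hNnonneg : ∀ x, 0 ≤ N x := fun x => add_nonneg (abs_nonneg _) (abs_nonneg _)
    have hsumV : ∀ x ∈ V, N x ≤ ∑ x ∈ V, N x := fun x hx =>
      Finset.single_le_sum (fun y _ => hNnonneg y) hx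
    have hsumQ : ∀ x ∈ Q, N x ≤ ∑ x ∈ Q, N x := fun x hx =>
      Finset.single_le_sum (fun y _ => hNnonneg y) hx
    have hsumV0 : 0 ≤ ∑ x ∈ V, N x := Finset.sum_nonneg fun y _ => hNnonneg y
    have hsumQ0 : 0 ≤ ∑ x ∈ Q, N x := Finset.sum_nonneg fun y _ => hNnonneg y
    apply not_sep hwS hwI
    refine ⟨k * a + c, k * b + d, fun q' hq' => ?_, fun w' hw' => ?_⟩
    · -- nonnegativity on Q
      have h1 : 1 ≤ lin a b q' := hposQ' q' hq'
      have h2 := hN q'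
      have h3 := hsumQ q' hq'
      have h4 : -(N q') ≤ lin c d q' := by
        have := neg_abs_le (lin c d q'); linarith
      have : 0 ≤ k * lin a b q' + lin c d q' := by
        have hk : N q' + 1 ≤ k := by
          simp only [k]; linarith [hNnonneg w]
        have hk0 : 0 ≤ k := by linarith [hNnonneg q']
        have hmul : k * 1 ≤ k * lin a b q' := mul_le_mul_of_nonneg_left h1 hk0
        linarith
      have e := lin_coeff_add a b c d k q'
      simp only [lin] at this e ⊢; linarith
    · -- strict separation of w below V
      have hw'v := hv_le w' hw'
      have e1 := lin_coeff_add a b c d k w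
      have e2 := lin_coeff_add a b c d k w'
      have gw := hN w
      have gw' := hN w'
      have gw1 : lin c d w ≤ N w := le_trans (le_abs_self _) gw
      have gw2 : -(N w') ≤ lin c d w' := by have := neg_abs_le (lin c d w'); linarith
      have hk1 : 1 + N w + N w' ≤ k := by
        simp only [k]; linarith [hsumV w' hw']
      suffices hsuff : k * lin a b w + lin c d w < k * lin a b w' + lin c d w' by
        simp only [lin] at hsuff e1 e2 ⊢; linarith
      by_cases hw'v' : w' = v
      · subst hw'v'
        have : k * lin a b w ≤ k * lin a b w' := by
          have hk0 : 0 ≤ k := by simp only [k]; linarith [hNnonneg w]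
          exact mul_le_mul_of_nonneg_left hle hk0
        linarith
      · have hlt : lin a b v < lin a b w' := hmin w' hw' hw'v'
        have hww' : lin a b w + 1 ≤ lin a b w' := by linarith
        have hk0 : 0 ≤ k := by simp only [k]; linarith [hNnonneg w]
        have hmul : k * (lin a b w + 1) ≤ k * lin a b w' := mul_le_mul_of_nonneg_left hww' hk0
        have hmul' : k * (lin a b w + 1) = k * lin a b w + k := by ring
        linarith
  exact ⟨I, Finset.mem_insert_self _ _, hID, goalA, goalB⟩

/-- **The linear two-sum vertex bound implies the linear core vertex bound** (same constant). -/
theorem coreVertexBoundLin_of_twoSumVertexBoundLin (h : TwoSumVertexBoundLin) : CoreVertexBoundLin := by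
  obtain ⟨c, hc⟩ := h
  refine ⟨c, fun Q V D h0V hVcl hvert hD => ?_⟩
  obtain ⟨I, h0I, hID, hval, hstr⟩ := exists_twoSum_model Q V D h0V hVcl hvert hD
  calc (V \ Q).card ≤ c * I.card := hc I (V \ Q) h0I hval hstr
    _ ≤ c * D.card := Nat.mul_le_mul_left _ (Finset.card_le_card hID)

end Summit.ValiantsHypothesis.ValiantsHypothesis.Theorems
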